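import Summits.Ventures.FusionMHD.Models.SolovevMercierAxisRegularNearAxis
import Summits.Ventures.FusionMHD.Models.SolovevPCFSafetyFactorProfile
import Summits.Ventures.FusionMHD.Bench.SolovevPCFIterMercierAxis
import Summits.Ventures.FusionMHD.Bench.SolovevPCFIterMercierEdgeKernel
import HarnessLib

/-!
# F1 / MERCIER — ITER-like PCF Solov'ev model: the flux-surface Mercier threshold `g_M(r)` CONVERGES, as the surface
# shrinks to the magnetic axis, to the certified near-axis (Bateman) threshold `F_M ∈ [0.61902799408906489484, …485)`
(venture LADDER-GRIDFUSION, rung F1.MERCIER; cell `gridfusion`, seat `gridfusion-model-7` (g4), 2026-08-27; instance corollary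
of the generic `Models/SolovevMercierAxisRegular*` set — ★ candidate #112 «F1.MERCIER-NEARAXIS-LIMIT-THM».)

The cell holds TWO printed Mercier criteria on this model: the near-axis form (Bateman (7.3.2), `Mercier.NearAxis.MercierCriterion`,
certified axis threshold bracket `[FmercLo, FmercHi]` of width `10⁻²⁰`, `Bench/SolovevPCFIterMercierAxis`, p472219) and the
flux-surface form (Jardin (8.134) on model-5's records `lcGGJData κ₀ F R_a q₀(F) (ε/R_a) F r`, certified two-sided thresholds on
seven surfaces `ρ/ρ_e = 1, 3/4, 1/2, 1/4, 1/8, 1/16` and the axis row; `…MercierNearAxisProfile` records the APPROACH as numbers,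
«the analytic limit statement not claimed»).  THIS FILE proves the limit statement for the instance, and (§0) supplies the `F`-free form of the regular numerators
(`slopeNumIter`, `interceptNumIter`, `lcRegNum_iter`: `C_s = 1`, `k = 2(1/2 + 4d₃)R_a`) with the whole-profile glue
`mercier_wholeProfile_iter` that the kernel certificate #105 «F1.MERCIER-WHOLE-PROFILE-ITER» (gridfusion-sos-6) closes cell by cell:
* `FmercAxis` — the exact axis threshold `√(κ₀(κ₀+1)(κ₀²+1)/(2r_q(κ₀²+3κ₀−2)))` (`κ₀² = Ψ_RR/Ψ_ZZ`, `r_q = q₀²/F²` exact);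
  `mercierNearAxis_iff`: for `F > 0`, Bateman's criterion `MercierCriterion (q₀ F) κ₀ 0 0 ↔ FmercAxis < F`; hence
  `FmercAxis_mem`: **`FmercLo ≤ FmercAxis < FmercHi`** from the two certified axis rows (no new numerics);
* **`tendsto_mercierThreshold_axis`** — for every `F > 0`: `lcMercierThreshold κ₀ F R_a (q₀ F) (ε/R_a) r → FmercAxis` as
  `r → 0⁺` (the threshold of the record `lcGGJData κ₀ F R_a (q₀ F) (ε/R_a) · r` is `F`-free): the certified profile
  `0.36703 (edge) < 0.47066 < 0.55079 < 0.60160 < 0.61465 < 0.61793` converges to the certified axis value — a THEOREM now;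
* **`eventually_mercier_of_lt` / `eventually_not_mercier_of_lt`** — for `F > F_M` (in particular `F ≥ FmercHi`) the
  flux-surface criterion (8.134) holds on every surface close enough to the axis — UNIFORMLY (`eventually_forall_mercier_of_lt`:
  one neighbourhood of the axis for all `F ≥ G > F_M`); for `0 < F < F_M` (in particular `F < FmercLo`) it fails there.
HONEST FRAMING: CERTIFIED/PROVED statements about the MODEL (ideal MHD, analytic fixed-boundary PCF Solov'ev equilibrium
[cite: PatakiCerfonFreidberg2013, §6.1], `F = RB_φ` free); Mercier is a NECESSARY local-interchange criterion; nothing here says a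
plasma or device is stable. No `decide`, no kit.
-/

noncomputable section

open Real Set Filter Topology
open Literature.MathematicalPhysics.MHD Literature.MathematicalPhysics.MHD.Solovev
open Literature.MathematicalPhysics.MHD.GradShafranov Literature.MathematicalPhysics.MHD.Mercier.NearAxis
open Summit.Ventures.FusionMHD.Models.SolovevPCF
open Summit.Ventures.FusionMHD.Models.LcMercierRegular

namespace Summit.Ventures.FusionMHD.Bench.SolovevPCFIter.MercierAxisLimit

/-! ## §0 F-elimination for the whole-profile certificate (#105): the regular numerators of the instance are F-free -/

/-- The `F`-free Lee–Cerfon amplitude of the instance: `k = κ₀F/(R_a²q₀(F)) = 2(1/2 + 4d₃)R_a` (`lcAmplitude`).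
[cite: PatakiCerfonFreidberg2013, §6.1] -/
def kIter : ℝ := 2 * (1 / 2 + 4 * IterLike.d₃) * IterLike.Ra

/-- `κ₀F/(R_a²q₀(F)) = kIter` for every `F > 0`. [cite: PatakiCerfonFreidberg2013, §6.1] -/
theorem k_eq_kIter {F : ℝ} (hF : 0 < F) : IterLike.kappa0 * F / (IterLike.Ra ^ 2 * IterLike.q0 F) = kIter := by
  have h := IterLike.lcAmplitude hF.ne'
  have hR := IterLike.Ra_pos
  have hq := IterLike.q0_pos hF
  rw [div_eq_iff (by positivity)] at h
  unfold kIter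
  rw [div_eq_iff (by positivity), h]
  ring

/-- The `F`-FREE regular slope numerator of the instance, `N₂(r)` with `C_s = 1`, `k = kIter`: a polynomial in the nine
regular integrals at `(κ₀, R_a, r)`. [cite: Jardin2010, §8.5.4 eq. (8.134)] -/
def slopeNumIter (r : ℝ) : ℝ :=
  9 * r ^ 2 * kIter ^ 2 * lcRegD5 IterLike.Ra r ^ 2 - 6 * kIter * lcRegD5 IterLike.Ra r * lcRegI6 IterLike.kappa0 IterLike.Ra r
    + (lcRegIX IterLike.kappa0 IterLike.Ra r ^ 2
        - lcRegI8 IterLike.kappa0 IterLike.Ra r * lcRegIY IterLike.kappa0 IterLike.Ra r / IterLike.Ra ^ 2)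
    + kIter * lcRegI7 IterLike.kappa0 IterLike.Ra r * lcRegD3 IterLike.Ra r

/-- The `F`-FREE regular intercept numerator of the instance, `N₀(r)` with `C_s = 1`, `k = kIter`. [cite: Jardin2010, §8.5.4 eq. (8.134)] -/
def interceptNumIter (r : ℝ) : ℝ :=
  kIter ^ 2 * lcRegIB IterLike.Ra r * lcRegI8 IterLike.kappa0 IterLike.Ra r
    - kIter ^ 3 * r ^ 2 * lcRegIB IterLike.Ra r * lcRegD3 IterLike.Ra r

/-- **For every `F > 0` the instance's regular numerators ARE the `F`-free ones:**
`lcRegSlopeNum κ₀ F R_a q₀(F) r = slopeNumIter r`, `lcRegInterceptNum κ₀ F R_a q₀(F) r = interceptNumIter r`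
(`C_s = 1` by `MercierEdge.csLC_edge`, `k = kIter`). [cite: Jardin2010, §8.5.4 eq. (8.134)] -/
theorem lcRegNum_iter {F : ℝ} (hF : 0 < F) (r : ℝ) :
    lcRegSlopeNum IterLike.kappa0 F IterLike.Ra (IterLike.q0 F) r = slopeNumIter r
    ∧ lcRegInterceptNum IterLike.kappa0 F IterLike.Ra (IterLike.q0 F) r = interceptNumIter r := by
  have hc := MercierEdge.csLC_edge hF
  have hk := k_eq_kIter hF
  unfold lcRegSlopeNum lcRegInterceptNum slopeNumIter interceptNumIter
  rw [hc, hk]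
  constructor <;> ring

/-- **WHOLE-PROFILE GLUE FOR THE INSTANCE (#105's assembly shape):** if the `F`-free cell inequality
`interceptNumIter r < G²·slopeNumIter r` holds for every `r ∈ (0, ε/R_a]` (all flux surfaces `0 < ψ_N ≤ 1`; `G > 0`), then
for EVERY `F ≥ G` Jardin's flux-surface Mercier criterion (8.134) holds on EVERY flux surface of the ITER-like model.
MODELLED: ideal MHD, analytic fixed-boundary PCF equilibrium; a NECESSARY-criterion statement, never «stable».
[cite: Jardin2010, §8.5.4 eq. (8.134)] -/
theorem mercier_wholeProfile_iter {G : ℝ} (hG : 0 < G)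
    (h : ∀ r ∈ Ioc 0 (IterLike.ε / IterLike.Ra), interceptNumIter r < G ^ 2 * slopeNumIter r) :
    ∀ F, G ≤ F → ∀ r ∈ Ioc 0 (IterLike.ε / IterLike.Ra),
      (lcGGJData IterLike.kappa0 F IterLike.Ra (IterLike.q0 F) (IterLike.ε / IterLike.Ra) F r).MercierCriterion := by
  intro F hGF r hr
  have hF : 0 < F := lt_of_lt_of_le hG hGF
  obtain ⟨h2, h0⟩ := lcRegNum_iter hF r
  have h2r : 2 * r < IterLike.Ra := by linarith [hr.2, IterLike.edge_minorRadius.2]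
  refine mercierCriterion_lcGGJData_of_regular IterLike.Ra_pos IterLike.kappa0_pos hF (IterLike.q0_pos hF) hr.1 h2r
    hG.le hGF ?_
  rw [h2, h0]
  exact h r hr


/-- The EXACT near-axis Mercier threshold of the ITER-like model in the free constant `F`:
`F_M = √(κ₀(κ₀+1)(κ₀²+1)/(2r_q(κ₀²+3κ₀−2)))`, `κ₀ = elongationOnAxis`, `r_q = q₀²/F² = IterLike.q0SqOverFSq`
(`= 1/√(r_q·bound κ₀ 0 0 1)`; float `0.619027994089`). [cite: Bateman1978, §7.3 eq. (7.3.2)] -/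
def FmercAxis : ℝ := Real.sqrt (IterLike.kappa0 * (IterLike.kappa0 + 1) * (IterLike.kappa0 ^ 2 + 1) / (2 * IterLike.q0SqOverFSq * (IterLike.kappa0 ^ 2 + 3 * IterLike.kappa0 - 2)))

/-- `κ₀² + 3κ₀ > 2` (indeed `κ₀² ≈ 2.977`). [folklore] -/
theorem kappa0_regular : 2 < IterLike.kappa0 ^ 2 + 3 * IterLike.kappa0 := by
  have h1 : IterLike.kappa0 ^ 2 = (2257675225 / 758468676 : ℝ) := by rw [IterLike.kappa0_sq]; rfl
  nlinarith [IterLike.kappa0_pos, h1]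

/-- The radicand of `F_M` is positive. [folklore] -/
theorem FmercAxis_sq_pos :
    0 < IterLike.kappa0 * (IterLike.kappa0 + 1) * (IterLike.kappa0 ^ 2 + 1) / (2 * IterLike.q0SqOverFSq * (IterLike.kappa0 ^ 2 + 3 * IterLike.kappa0 - 2)) := by
  have hk := IterLike.kappa0_pos
  have h2 : 0 < IterLike.kappa0 ^ 2 + 3 * IterLike.kappa0 - 2 := by linarith [kappa0_regular]
  have hr : 0 < IterLike.q0SqOverFSq := by unfold IterLike.q0SqOverFSq; norm_num
  positivity

/-- **Bateman's near-axis criterion on the instance is the threshold `F_M < F`** (`F > 0`). [cite: Bateman1978, §7.3 eq. (7.3.2)] -/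
theorem mercierNearAxis_iff {F : ℝ} (hF : 0 < F) : MercierCriterion (IterLike.q0 F) IterLike.kappa0 0 0 ↔ FmercAxis < F := by
  have hk := IterLike.kappa0_pos
  have h2 : 0 < IterLike.kappa0 ^ 2 + 3 * IterLike.kappa0 - 2 := by linarith [kappa0_regular]
  have hr : 0 < IterLike.q0SqOverFSq := by unfold IterLike.q0SqOverFSq; norm_num
  have hrad := FmercAxis_sq_pos
  have hq : IterLike.q0 F ^ 2 = F ^ 2 * IterLike.q0SqOverFSq := IterLike.q0_sq F
  -- both sides ↔ κ₀(κ₀+1)(κ₀²+1) < 2F²r_q(κ₀²+3κ₀−2)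
  have hP : MercierCriterion (IterLike.q0 F) IterLike.kappa0 0 0
      ↔ 0 < 2 * F ^ 2 * IterLike.q0SqOverFSq * (IterLike.kappa0 ^ 2 + 3 * IterLike.kappa0 - 2) - IterLike.kappa0 * (IterLike.kappa0 + 1) * (IterLike.kappa0 ^ 2 + 1) := by
    unfold MercierCriterion bound
    rw [← sub_pos, hq]
    have e : 6 / (1 + IterLike.kappa0 ^ 2) - 4 / (IterLike.kappa0 * (IterLike.kappa0 + 1)) + 0 * (4 / (IterLike.kappa0 * (IterLike.kappa0 + 1)) - 2)
        + (IterLike.kappa0 ^ 2 - 1) / (IterLike.kappa0 ^ 2 + 1) * 0 - 1 / (F ^ 2 * IterLike.q0SqOverFSq)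
        = 1 / ((1 + IterLike.kappa0 ^ 2) * IterLike.kappa0 * (IterLike.kappa0 + 1) * F ^ 2 * IterLike.q0SqOverFSq)
          * (2 * F ^ 2 * IterLike.q0SqOverFSq * (IterLike.kappa0 ^ 2 + 3 * IterLike.kappa0 - 2) - IterLike.kappa0 * (IterLike.kappa0 + 1) * (IterLike.kappa0 ^ 2 + 1)) := by
      field_simp; ring
    rw [e, mul_pos_iff_of_pos_left (by positivity)]
  have hQ : FmercAxis < F
      ↔ 0 < 2 * F ^ 2 * IterLike.q0SqOverFSq * (IterLike.kappa0 ^ 2 + 3 * IterLike.kappa0 - 2) - IterLike.kappa0 * (IterLike.kappa0 + 1) * (IterLike.kappa0 ^ 2 + 1) := by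
    unfold FmercAxis
    rw [Real.sqrt_lt' hF, div_lt_iff₀ (by positivity), ← sub_pos]
    constructor <;> intro h <;> linarith
  exact hP.trans hQ.symm

/-- **The exact axis threshold lies in the certified bracket: `FmercLo ≤ F_M < FmercHi`** (from the two certified axis rows
`mercier_elong_of_le`, `not_mercier_elong_of_le` of `…MercierAxis`; width `≤ 10⁻²⁰`). [cite: Bateman1978, §7.3 eq. (7.3.2)] -/
theorem FmercAxis_mem : MercierAxis.FmercLo ≤ FmercAxis ∧ FmercAxis < MercierAxis.FmercHi := by
  have hlo : 0 < MercierAxis.FmercLo := by unfold MercierAxis.FmercLo; norm_num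
  have hhi : 0 < MercierAxis.FmercHi := by unfold MercierAxis.FmercHi; norm_num
  have e1 : MercierAxis.elong = IterLike.kappa0 := rfl
  have eq : ∀ F, MercierAxis.q0 F = IterLike.q0 F := fun F => rfl
  constructor
  · have h := MercierAxis.not_mercier_elong_of_le hlo le_rfl
    rw [e1, eq, mercierNearAxis_iff hlo, not_lt] at h
    exact h
  · have h := MercierAxis.mercier_elong_of_le (le_refl MercierAxis.FmercHi)
    rw [e1, eq, mercierNearAxis_iff hhi] at h
    exact h

/-- **THE FLUX-SURFACE MERCIER THRESHOLD CONVERGES TO THE AXIS THRESHOLD:** for every `F > 0`, the threshold `g_M(r)` of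
Jardin's (8.134) on the surface `r` of the ITER-like model (record `lcGGJData κ₀ F R_a (q₀ F) (IterLike.ε/R_a) · r`, `F`-free threshold)
tends to `F_M` as `r → 0⁺`. [cite: Jardin2010, §8.5.4 eq. (8.134)] -/
theorem tendsto_mercierThreshold_axis {F : ℝ} (hF : 0 < F) :
    Tendsto (fun r => lcMercierThreshold IterLike.kappa0 F IterLike.Ra (IterLike.q0 F) (IterLike.ε / IterLike.Ra) r) (𝓝[>] 0) (𝓝 FmercAxis) := by
  have h := tendsto_lcMercierThreshold_axis_closedForm IterLike.Ra_pos IterLike.kappa0_pos hF (IterLike.q0_pos hF) (IterLike.ε / IterLike.Ra) kappa0_regular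
  have hq : IterLike.q0 F ^ 2 = F ^ 2 * IterLike.q0SqOverFSq := IterLike.q0_sq F
  have hr : IterLike.q0SqOverFSq ≠ 0 := by unfold IterLike.q0SqOverFSq; norm_num
  have h2 : IterLike.kappa0 ^ 2 + 3 * IterLike.kappa0 - 2 ≠ 0 := by linarith [kappa0_regular]
  have e : F ^ 2 * IterLike.kappa0 * (IterLike.kappa0 + 1) * (IterLike.kappa0 ^ 2 + 1) / (2 * IterLike.q0 F ^ 2 * (IterLike.kappa0 ^ 2 + 3 * IterLike.kappa0 - 2))
      = IterLike.kappa0 * (IterLike.kappa0 + 1) * (IterLike.kappa0 ^ 2 + 1) / (2 * IterLike.q0SqOverFSq * (IterLike.kappa0 ^ 2 + 3 * IterLike.kappa0 - 2)) := by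
    rw [hq]; field_simp
  unfold FmercAxis
  rw [← e]
  exact h

/-- **Above the axis threshold (`F_M < F`) the flux-surface Mercier criterion (8.134) holds on EVERY surface of the ITER-like
model sufficiently close to the magnetic axis.** [cite: Jardin2010, §8.5.4 eq. (8.134)] -/
theorem eventually_mercier_of_lt {F : ℝ} (hF : FmercAxis < F) :
    ∀ᶠ r in 𝓝[>] (0 : ℝ), (lcGGJData IterLike.kappa0 F IterLike.Ra (IterLike.q0 F) (IterLike.ε / IterLike.Ra) F r).MercierCriterion := by
  have hF0 : 0 < F := lt_of_le_of_lt (Real.sqrt_nonneg _) hF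
  have hB : MercierCriterion (F * IterLike.q0 F / F) IterLike.kappa0 0 0 := by
    rw [mul_div_cancel_left₀ _ hF0.ne']
    exact (mercierNearAxis_iff hF0).2 hF
  exact eventually_mercierCriterion_of_nearAxis IterLike.Ra_pos IterLike.kappa0_pos hF0 (IterLike.q0_pos hF0) (IterLike.ε / IterLike.Ra) hF0 hB

/-- **UNIFORM VERSION:** above the axis threshold there is ONE neighbourhood of the axis on which the flux-surface criterion
holds for EVERY larger free constant: `F_M < G ⇒ ∀ᶠ r → 0⁺, ∀ F ≥ G, (8.134)` on the surface `r`.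
[cite: Jardin2010, §8.5.4 eq. (8.134)] -/
theorem eventually_forall_mercier_of_lt {G : ℝ} (hG : FmercAxis < G) :
    ∀ᶠ r in 𝓝[>] (0 : ℝ), ∀ F, G ≤ F →
      (lcGGJData IterLike.kappa0 F IterLike.Ra (IterLike.q0 F) (IterLike.ε / IterLike.Ra) F r).MercierCriterion := by
  have hG0 : 0 < G := lt_of_le_of_lt (Real.sqrt_nonneg _) hG
  have hB : MercierCriterion (G * IterLike.q0 G / G) IterLike.kappa0 0 0 := by
    rw [mul_div_cancel_left₀ _ hG0.ne']
    exact (mercierNearAxis_iff hG0).2 hG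
  have hev := eventually_regular_of_nearAxis IterLike.Ra_pos IterLike.kappa0_pos hG0 (IterLike.q0_pos hG0) hG0 hB
  filter_upwards [hev] with r hr F hGF
  have hF : 0 < F := lt_of_lt_of_le hG0 hGF
  obtain ⟨h2G, h0G⟩ := lcRegNum_iter hG0 r
  obtain ⟨h2F, h0F⟩ := lcRegNum_iter hF r
  have h2r : 2 * r < IterLike.Ra := by linarith [hr.1.2]
  refine mercierCriterion_lcGGJData_of_regular IterLike.Ra_pos IterLike.kappa0_pos hF (IterLike.q0_pos hF) hr.1.1 h2r
    hG0.le hGF ?_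
  rw [h2F, h0F, ← h2G, ← h0G]
  exact hr.2

/-- In particular for every `F ≥ FmercHi = 0.61902799408906489485` (the certified upper end of the axis bracket).
[cite: Jardin2010, §8.5.4 eq. (8.134)] -/
theorem eventually_mercier_of_le {F : ℝ} (hF : MercierAxis.FmercHi ≤ F) :
    ∀ᶠ r in 𝓝[>] (0 : ℝ), (lcGGJData IterLike.kappa0 F IterLike.Ra (IterLike.q0 F) (IterLike.ε / IterLike.Ra) F r).MercierCriterion :=
  eventually_mercier_of_lt (lt_of_lt_of_le FmercAxis_mem.2 hF)

/-- **Below the axis threshold (`0 < F < F_M`) the flux-surface criterion FAILS on every surface sufficiently close to the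
axis.** [cite: Jardin2010, §8.5.4 eq. (8.134)] -/
theorem eventually_not_mercier_of_lt {F : ℝ} (hF0 : 0 < F) (hF : F < FmercAxis) :
    ∀ᶠ r in 𝓝[>] (0 : ℝ), ¬ (lcGGJData IterLike.kappa0 F IterLike.Ra (IterLike.q0 F) (IterLike.ε / IterLike.Ra) F r).MercierCriterion := by
  have hk := IterLike.kappa0_pos
  have h2 : 0 < IterLike.kappa0 ^ 2 + 3 * IterLike.kappa0 - 2 := by linarith [kappa0_regular]
  have hr : 0 < IterLike.q0SqOverFSq := by unfold IterLike.q0SqOverFSq; norm_num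
  have hq : IterLike.q0 F ^ 2 = F ^ 2 * IterLike.q0SqOverFSq := IterLike.q0_sq F
  have hB : bound IterLike.kappa0 0 0 1 < 1 / (F * IterLike.q0 F / F) ^ 2 := by
    rw [mul_div_cancel_left₀ _ hF0.ne', hq]
    have hlt : F ^ 2 < IterLike.kappa0 * (IterLike.kappa0 + 1) * (IterLike.kappa0 ^ 2 + 1) / (2 * IterLike.q0SqOverFSq * (IterLike.kappa0 ^ 2 + 3 * IterLike.kappa0 - 2)) := by
      have := hF
      unfold FmercAxis at this
      rw [Real.lt_sqrt hF0.le] at this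
      exact this
    rw [lt_div_iff₀ (by positivity)] at hlt
    unfold bound
    rw [← sub_pos]
    have e : 1 / (F ^ 2 * IterLike.q0SqOverFSq) - (6 / (1 + IterLike.kappa0 ^ 2) - 4 / (IterLike.kappa0 * (IterLike.kappa0 + 1))
        + 0 * (4 / (IterLike.kappa0 * (IterLike.kappa0 + 1)) - 2) + (IterLike.kappa0 ^ 2 - 1) / (IterLike.kappa0 ^ 2 + 1) * 0)
        = 1 / ((1 + IterLike.kappa0 ^ 2) * IterLike.kappa0 * (IterLike.kappa0 + 1) * F ^ 2 * IterLike.q0SqOverFSq)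
          * (IterLike.kappa0 * (IterLike.kappa0 + 1) * (IterLike.kappa0 ^ 2 + 1) - 2 * F ^ 2 * IterLike.q0SqOverFSq * (IterLike.kappa0 ^ 2 + 3 * IterLike.kappa0 - 2)) := by
      field_simp; ring
    rw [e, mul_pos_iff_of_pos_left (by positivity)]
    linarith
  exact eventually_not_mercierCriterion_of_nearAxis_lt IterLike.Ra_pos IterLike.kappa0_pos hF0 (IterLike.q0_pos hF0) (IterLike.ε / IterLike.Ra) hF0 hB

/-- In particular for every `0 < F < FmercLo = 0.61902799408906489484` (the certified lower end of the axis bracket).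
[cite: Jardin2010, §8.5.4 eq. (8.134)] -/
theorem eventually_not_mercier_of_lt_FmercLo {F : ℝ} (hF0 : 0 < F) (hF : F < MercierAxis.FmercLo) :
    ∀ᶠ r in 𝓝[>] (0 : ℝ), ¬ (lcGGJData IterLike.kappa0 F IterLike.Ra (IterLike.q0 F) (IterLike.ε / IterLike.Ra) F r).MercierCriterion :=
  eventually_not_mercier_of_lt hF0 (lt_of_lt_of_le hF FmercAxis_mem.1)

end Summit.Ventures.FusionMHD.Bench.SolovevPCFIter.MercierAxisLimit

end
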